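import Mathlib
import Summits.ResolutionOfSingularities.ResolutionOfSingularities.Theorems.HomologicalConductorPersistenceCyclicTransferCoinduced
import Summits.ResolutionOfSingularities.ResolutionOfSingularities.Theorems.HomologicalConductorNoZenoStableAnnihilatorReduction
import HarnessLib

/-!
# Rung S-2 `PersistenceSurface` (stmt-ResolutionOfSingularities-19970) — the CONDUCTOR FLOOR, algebraic core:
# stable annihilation transfers DOWN a finite birational extension through the coextension `Hom_B(C, –)`

Route `ResolutionOfSingularities/HomologicalConductor`, chain W4.4b (cell `res-hironaka`), rung S-2
`PersistenceSurface` (stmt-ResolutionOfSingularities-19970), registered stub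
`stub_levelFourPersistenceNonnormalOrNonrational'` (L-other′; class Σ8 = NON-NORMAL stage `0`), cell R5 / S-c
(«ca(A)·Ā vs 𝔠·ca(Ā)»).  Seat res-L1-w44b-lead-1 (gen 3); companion of `…PersistenceConductorCeiling` (p550697,
`ca³(B) ⊆ 𝔠`).  `[OURS · L1 w44b]`; folklore module theory; NOT a statement of the manuscript under review
(Hironaka 2017), no statement of that manuscript is used; AI-written, weaker than expert review.

## Statement (`exists_factor_of_coextension_factor`)

Let `B → C` be an injective map of commutative rings, `c, c' ∈ B` CONDUCTOR elements (`c·C ⊆ B`, `c'·C ⊆ B`),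
`K` a `B`-module and `W(K) := Hom_B(C, K)` its COEXTENSION, a `C`-module by `(γ • θ)(δ) = θ(δγ)` (Mathlib's
`ModuleCat.CoextendScalars`, spelled `((ModuleCat.restrictScalars (algebraMap B C)).obj (ModuleCat.of C C)) →ₗ[B] K`
as in the tree's `…PersistenceCyclicTransferCoinduced`).  If the homothety `y • 𝟙` of `W(K)` (`y ∈ C`) factors
`C`-linearly through a finite free `C`-module, `W(K) —ψ→ Cᵐ —g→ W(K)`, `g ∘ ψ = y • 𝟙`, then the homothety
`(c·c'y) • 𝟙_K` factors `B`-linearly through `Bᵐ` (`c'y ∈ B` is the element `b` with `b = c'·y` in `C`):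

  `K —ι'→ W(K) —ψ→ Cᵐ —(·c')→ Bᵐ —incl→ Cᵐ —g→ W(K) —ev₁→ K`,  `ι'(k) = (γ ↦ (cγ)·k)`, `ev₁(θ) = θ(1)`:

`ev₁ (g (c' • ψ (ι' k))) = ev₁ ((c'y) • ι' k) = (ι' k)(c'y) = (c·c'y)·k`.  Hence
`StablyAnnihilates B (c·c'y) K` (`stablyAnnihilates_of_coextension_factor`).

USE (the floor «`𝔠²·ca³(C) ⊆ ca³(B)`» for a PRINCIPAL conductor `𝔠 = aC`, to be assembled by the chain): for
`K` a second `B`-syzygy, `W(K) = ker (W(P) → W(P'))` with `W(P)`, `W(P')` finitely generated projective over `C`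
(`W(B) = Hom_B(C,B) ≅ 𝔠 ≅ C`), so `W(K)` is a second `C`-syzygy and every `y ∈ ca³(C)` supplies the
factorisation `ψ, g` (dimension shifting + the tree's dual splitting criterion); with this file and CA1
(`mem_cohomologyAnnihilatorOfDegree_succ_iff_forall_isSyzygy`) `c·c'·y ∈ ca³(B)`.

References (mechanism only): S. B. Iyengar, R. Takahashi, IMRN 2016, Remark 2.13 [`IyengarTakahashi2014`];
coextension of scalars is folklore (Mathlib `ModuleCat.CoextendScalars`).
-/

-- single-problem summit: the doubled namespace component `ResolutionOfSingularities` is forced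
set_option linter.dupNamespace false

noncomputable section

open CategoryTheory Literature.RingTheory.CohomologyAnnihilator
open Summit.ResolutionOfSingularities.ResolutionOfSingularities.Theorems.NoZeno.SandwichCluster
open Summit.ResolutionOfSingularities.ResolutionOfSingularities.Theorems.HomologicalConductor.PersistenceCyclicTransferCoinduced
  (isScalarTower_coinduced)

universe u

namespace Summit.ResolutionOfSingularities.ResolutionOfSingularities.Theorems.HomologicalConductor.PersistenceConductorCoextension

variable {B C : Type u} [CommRing B] [CommRing C] [Algebra B C]

/-! ## Conductor elements as `B`-linear maps `C → B` -/

/-- A conductor element `c` (`c·C ⊆ B`) of an INJECTIVE ring map `B → C` defines the `B`-linear map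
`μ_c : C → B`, `γ ↦ cγ` (the unique preimage). [folklore] -/
theorem exists_linearMap_conductor (hinj : Function.Injective (algebraMap B C)) {c : B}
    (hc : ∀ γ : C, ∃ b : B, algebraMap B C b = algebraMap B C c * γ) :
    ∃ μ : C →ₗ[B] B, ∀ γ : C, algebraMap B C (μ γ) = algebraMap B C c * γ := by
  choose v hv using hc
  refine ⟨{ toFun := v
            map_add' := fun γ δ => hinj (by rw [map_add, hv, hv, hv, mul_add])
            map_smul' := fun b γ => hinj (by
              rw [RingHom.id_apply, Algebra.smul_def, smul_eq_mul, map_mul, hv, hv]; ring) }, hv⟩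

/-! ## The transfer -/

/-- **Stable annihilation transfers down a finite birational extension through the coextension.**
`B → C` injective, `c, c'` conductor elements, `K` a `B`-module, `W(K) = Hom_B(C, K)` with its coextended
`C`-structure; if `y • 𝟙_{W(K)}` factors `C`-linearly through `Cᵐ` then `(c·b) • 𝟙_K` factors `B`-linearly
through `Bᵐ`, where `b ∈ B` is the element with `b = c'y` in `C`. See the module docstring for the six-map
factorisation. [folklore] -/
theorem exists_factor_of_coextension_factor (hinj : Function.Injective (algebraMap B C)) {c c' : B}
    (hc : ∀ γ : C, ∃ b : B, algebraMap B C b = algebraMap B C c * γ)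
    (hc' : ∀ γ : C, ∃ b : B, algebraMap B C b = algebraMap B C c' * γ)
    (K : Type u) [AddCommGroup K] [Module B K] {y : C} {b : B}
    (hb : algebraMap B C b = algebraMap B C c' * y) {m : ℕ}
    (ψ : (((ModuleCat.restrictScalars (algebraMap B C)).obj (ModuleCat.of C C)) →ₗ[B] K) →ₗ[C] (Fin m → C))
    (g : (Fin m → C) →ₗ[C] (((ModuleCat.restrictScalars (algebraMap B C)).obj (ModuleCat.of C C)) →ₗ[B] K))
    (hψg : ∀ θ, g (ψ θ) = y • θ) :
    ∃ (ι : K →ₗ[B] (Fin m → B)) (π : (Fin m → B) →ₗ[B] K), ∀ k : K, π (ι k) = (c * b) • k := by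
  classical
  haveI := isScalarTower_coinduced (U := B) (V := C) K
  -- the two identifications of the carrier of `C|_B` with `C`
  let toW : C → ((ModuleCat.restrictScalars (algebraMap B C)).obj (ModuleCat.of C C)) := fun v => v
  let ofW : ((ModuleCat.restrictScalars (algebraMap B C)).obj (ModuleCat.of C C)) → C := fun w => w
  have ofW_smul : ∀ (r : B) (w : ((ModuleCat.restrictScalars (algebraMap B C)).obj (ModuleCat.of C C))),
      ofW (r • w) = algebraMap B C r * ofW w := fun r w => by
    rw [ModuleCat.restrictScalars.smul_def (M := ModuleCat.of C C)]
    rfl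
  have smul_apply'' : ∀ (s : C)
      (θ : ((ModuleCat.restrictScalars (algebraMap B C)).obj (ModuleCat.of C C)) →ₗ[B] K) (w),
      (s • θ) w = θ (toW (ofW w * s)) := fun _ _ _ => rfl
  -- conductor multiplications `μ_c, μ_{c'} : C → B`
  obtain ⟨μ, hμ⟩ := exists_linearMap_conductor hinj hc
  obtain ⟨μ', hμ'⟩ := exists_linearMap_conductor hinj hc'
  -- `ι' : K → W(K)`, `k ↦ (γ ↦ (cγ) • k)`
  let ι' : K →ₗ[B] (((ModuleCat.restrictScalars (algebraMap B C)).obj (ModuleCat.of C C)) →ₗ[B] K) :=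
    { toFun := fun k =>
        { toFun := fun w => μ (ofW w) • k
          map_add' := fun w w' => by
            change μ (ofW w + ofW w') • k = _
            rw [map_add, add_smul]
          map_smul' := fun r w => by
            rw [RingHom.id_apply, ofW_smul, ← Algebra.smul_def, map_smul, smul_assoc] }
      map_add' := fun k k' => by
        apply LinearMap.ext
        intro w
        change μ (ofW w) • (k + k') = μ (ofW w) • k + μ (ofW w) • k'
        rw [smul_add]
      map_smul' := fun r k => by
        apply LinearMap.ext
        intro w
        change μ (ofW w) • (r • k) = r • (μ (ofW w) • k)
        rw [smul_comm] }
  have ι'_apply : ∀ k w, ι' k w = μ (ofW w) • k := fun _ _ => rfl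
  -- `ev₁ : W(K) → K`
  let ev₁ : (((ModuleCat.restrictScalars (algebraMap B C)).obj (ModuleCat.of C C)) →ₗ[B] K) →ₗ[B] K :=
    { toFun := fun θ => θ (toW 1)
      map_add' := fun θ θ' => rfl
      map_smul' := fun r θ => rfl }
  -- `Cᵐ → Bᵐ` (multiplication by `c'`) and `Bᵐ → Cᵐ` (inclusion)
  let toB : (Fin m → C) →ₗ[B] (Fin m → B) :=
    { toFun := fun v i => μ' (v i)
      map_add' := fun v v' => by ext i; simp
      map_smul' := fun r v => by ext i; simp }
  let toC : (Fin m → B) →ₗ[B] (Fin m → C) :=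
    { toFun := fun w i => algebraMap B C (w i)
      map_add' := fun w w' => by ext i; simp
      map_smul' := fun r w => by ext i; simp [Algebra.smul_def] }
  have htoC : ∀ v : Fin m → C, toC (toB v) = algebraMap B C c' • v := by
    intro v
    ext i
    change algebraMap B C (μ' (v i)) = algebraMap B C c' * v i
    exact hμ' (v i)
  refine ⟨toB ∘ₗ (ψ.restrictScalars B) ∘ₗ ι', ev₁ ∘ₗ (g.restrictScalars B) ∘ₗ toC, fun k => ?_⟩
  change ev₁ (g (toC (toB (ψ (ι' k))))) = (c * b) • k
  rw [htoC, map_smul, hψg, smul_smul]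
  change ((algebraMap B C c' * y) • ι' k) (toW 1) = (c * b) • k
  have key : μ (algebraMap B C c' * y) = c * b := by
    apply hinj
    rw [hμ, map_mul, hb]
  rw [smul_apply'', ι'_apply]
  change μ ((1 : C) * (algebraMap B C c' * y)) • k = (c * b) • k
  rw [one_mul, key]

/-- **`StablyAnnihilates B (c·c'y) K`** under the hypotheses of `exists_factor_of_coextension_factor`
(`ModuleCat` packaging for CA1 `mem_cohomologyAnnihilatorOfDegree_succ_iff_forall_isSyzygy`). [folklore] -/
theorem stablyAnnihilates_of_coextension_factor (hinj : Function.Injective (algebraMap B C)) {c c' : B}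
    (hc : ∀ γ : C, ∃ b : B, algebraMap B C b = algebraMap B C c * γ)
    (hc' : ∀ γ : C, ∃ b : B, algebraMap B C b = algebraMap B C c' * γ)
    (K : ModuleCat.{u} B) {y : C} {b : B} (hb : algebraMap B C b = algebraMap B C c' * y) {m : ℕ}
    (ψ : (((ModuleCat.restrictScalars (algebraMap B C)).obj (ModuleCat.of C C)) →ₗ[B] K) →ₗ[C] (Fin m → C))
    (g : (Fin m → C) →ₗ[C] (((ModuleCat.restrictScalars (algebraMap B C)).obj (ModuleCat.of C C)) →ₗ[B] K))
    (hψg : ∀ θ, g (ψ θ) = y • θ) :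
    StablyAnnihilates B (c * b) K := by
  obtain ⟨ι, π, h⟩ := exists_factor_of_coextension_factor hinj hc hc' K hb ψ g hψg
  refine ⟨ModuleCat.of B (Fin m → B), inferInstance,
    (IsProjective.iff_projective (R := B) (Fin m → B)).mp inferInstance,
    ModuleCat.ofHom ι, ModuleCat.ofHom π, ?_⟩
  ext k
  simpa using h k

end Summit.ResolutionOfSingularities.ResolutionOfSingularities.Theorems.HomologicalConductor.PersistenceConductorCoextension

end
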